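import Summits.KontsevichZagierPeriods.Zeta5Search.QWedgeClosedFormProof
import Summits.KontsevichZagierPeriods.Zeta5Search.WedgeDictionaryFace
import HarnessLib

/-!
# The `Q`-part of the wedge dictionary is UNCONDITIONAL on every face `{b_j = 0}` (cell `pub-zeta5`, TYPER g6)

HONEST FRAMING: systematic search; no irrationality claim unless certified.

Assembly of three landed results into the first hypothesis-free piece of the internally-minted conjecture
`wedgeDictionary` (gen-1, `WedgeDictionary.lean`): for `a` in the conjecture's region whose dual parameters
`b = b(a)` have SOME zero slot `b_j = 0` (`j ∈ [1,7]`),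

* `qPart_of_slot_zero` : `Q(a) = ρ(a) · M₃(b(a))` (j-free form), and
* `wedgeDictionary_Q_of_slot_zero` : the first conjunct of `wedgeDictionary` literally,
  `Q(a) = ρ(a) · (U(b)W(b′) − U(b′)W(b))`, `b′ = b + e_k`, for every admissible partner `k`.

Ingredients: CF-Q (`WedgeDictionary.QWedgeClosedForm_holds`, typer g6, `QWedgeClosedFormProof.lean`) through its
pointwise corollary `qPart_of_casoratianClosedForm_at`; CF-M3 on all faces (`casoratianClosedForm_of_slot_zero`,
lit g4, `WedgeDictionaryFace.lean`); the two vanishing halves (gen-1 g4, `WedgeDictionaryVanishing.lean`) through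
`qPart_of_exceeding_pair`; and the j-free reformulation `Q_part_iff_quadM3` (`WedgeDictionaryQuadratic.lean`).
The interior (all `b_j ≥ 1`) waits for CF-M3 there (gen-1 g5's plan L4–L9; L4, L6, L7 are in the tree).
-/

open Finset

namespace Summit.KontsevichZagierPeriods.Zeta5Search.WedgeDictionary

open Summit.KontsevichZagierPeriods.Zeta5Search.CFQ
open Summit.KontsevichZagierPeriods.Zeta5Search.DualSeries (InBox)
open Literature.NumberTheory.Irrationality.BrownZudilin2022 (bOfA Converges QOf)

/-- All 21 pair sums are `≤ b₀` once the six (35)-pairs are (the fifteen `E`-pairs are convergence forms). -/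
theorem allPairs_le_of_nonEpairs (a : Fin 8 → ℤ) (hconv : Converges a)
    (hne : ∀ jk ∈ nonEpairs, bOfA a jk.1 + bOfA a jk.2 ≤ bOfA a 0) :
    ∀ jk ∈ allPairs, bOfA a jk.1 + bOfA a jk.2 ≤ bOfA a 0 := by
  have hE := epairs_le_of_converges a hconv
  intro jk hjk
  simp only [allPairs, List.mem_cons, List.mem_nil_iff, or_false] at hjk
  rcases hjk with rfl | rfl | rfl | rfl | rfl | rfl | rfl | rfl | rfl | rfl | rfl | rfl | rfl | rfl | rfl | rfl |
      rfl | rfl | rfl | rfl | rfl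
  exacts [hE (1,2) (by simp [Epairs]), hE (1,3) (by simp [Epairs]), hE (1,4) (by simp [Epairs]),
    hE (1,5) (by simp [Epairs]), hne (1,6) (by simp [nonEpairs]), hne (1,7) (by simp [nonEpairs]),
    hE (2,3) (by simp [Epairs]), hE (2,4) (by simp [Epairs]), hE (2,5) (by simp [Epairs]), hE (2,6) (by simp [Epairs]),
    hne (2,7) (by simp [nonEpairs]), hE (3,4) (by simp [Epairs]), hne (3,5) (by simp [nonEpairs]),
    hE (3,6) (by simp [Epairs]), hE (3,7) (by simp [Epairs]), hne (4,5) (by simp [nonEpairs]),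
    hne (4,6) (by simp [nonEpairs]), hE (4,7) (by simp [Epairs]), hE (5,6) (by simp [Epairs]), hE (5,7) (by simp [Epairs]),
    hE (6,7) (by simp [Epairs])]

/-- **The `Q`-part of `wedgeDictionary` is UNCONDITIONAL on every face** (j-free form): for `a` in the region with some
`b(a)_j = 0`, `j ∈ [1,7]`, `Q(a) = ρ(a)·M₃(b(a))` — CF-Q (typer g6) + CF-M3 on faces (lit g4,
`casoratianClosedForm_of_slot_zero`) + the vanishing halves (gen-1 g4). -/
theorem qPart_of_slot_zero (a : Fin 8 → ℤ) (hconv : Converges a)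
    (hreg : ∀ i ∈ Icc 1 7, 0 ≤ bOfA a i ∧ 2 * bOfA a i ≤ bOfA a 0 + 1) (hd : 0 ≤ dOf (bOfA a))
    {j : ℕ} (hj : j ∈ Icc 1 7) (hj0 : bOfA a j = 0) :
    (QOf a : ℚ) = rhoOf a * quadM3 (bOfA a) := by
  by_cases hne : ∀ jk ∈ nonEpairs, bOfA a jk.1 + bOfA a jk.2 ≤ bOfA a 0
  · have hall := allPairs_le_of_nonEpairs a hconv hne
    have hnn : ∀ i ∈ Icc 1 7, 0 ≤ bOfA a i := fun i hi => (hreg i hi).1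
    obtain ⟨hIB, hle⟩ := inBox_of_full a hconv hnn
    exact qPart_of_casoratianClosedForm_at a hconv hreg hd hall
      (casoratianClosedForm_of_slot_zero (bOfA a) hIB hd hle hall hj hj0)
  · push Not at hne
    obtain ⟨jk, hjk, hlt⟩ := hne
    exact qPart_of_exceeding_pair a hconv hreg hd ⟨jk, hjk, hlt⟩

/-- **The first conjunct of `wedgeDictionary`, literally, on the faces**: for `a` in the region, an admissible partner `k`
(`2(b_k + 1) ≤ b₀ + 1`) and some `b(a)_j = 0`:
`Q(a) = ρ(a) · (U(b)W(b′) − U(b′)W(b))`, `b = b(a)`, `b′ = b + e_k`. -/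
theorem wedgeDictionary_Q_of_slot_zero (a : Fin 8 → ℤ) (hconv : Converges a)
    (hreg : ∀ i ∈ Icc 1 7, 0 ≤ bOfA a i ∧ 2 * bOfA a i ≤ bOfA a 0 + 1) (hd : 0 ≤ dOf (bOfA a))
    {k : ℕ} (hk : k ∈ Icc 1 7) (hpart : 2 * (bOfA a k + 1) ≤ bOfA a 0 + 1)
    {j : ℕ} (hj : j ∈ Icc 1 7) (hj0 : bOfA a j = 0) :
    (QOf a : ℚ) = rhoOf a * (coeffU (bOfA a) * coeffW (Function.update (bOfA a) k (bOfA a k + 1)) -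
        coeffU (Function.update (bOfA a) k (bOfA a k + 1)) * coeffW (bOfA a)) :=
  (Q_part_iff_quadM3 a hk hreg hd hpart).2 (qPart_of_slot_zero a hconv hreg hd hj hj0)

end Summit.KontsevichZagierPeriods.Zeta5Search.WedgeDictionary
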